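import Literature.MathematicalPhysics.QuantumFieldTheory.Balaban1983to89.T4TermwiseQuartic

/-!
# TermwiseHeterogeneous — the one-step interpolation/averaging sandwich (U)(L) with POSITION-DEPENDENT radii, its
level-graded form, and the summability census of the term-wise action kind over histories with rough regions

Cell `pub-balaban`, rung (B)+1 sub-cell t4, lineage `b2b-balaban-t4-ne7-p1` (node U5 = spine estimate NE7, TERM-WISE
member; generation 16), record `t4/T4-EST-NE7-P1.md` §20 (20g).  HONEST FRAMING (page 1): pure YM₄ on a FIXED FINITE
torus T⁴; the target of the sub-cell is the `ε → 0` limit of unit-scale averaged expectations of gauge-invariant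
observables, CONDITIONAL on BetaPertH and the nine spine estimates (0/9 proved); NOT infinite volume, NOT a mass gap,
NOT the Clay problem.  NE7 is NOT PRINTED in [Balaban1984PropagatorsI]–[Balaban1989LargeFieldII] and NOT proved here.
This module is an EDISONIAN CENSUS ITEM of the term-wise technique, typed: elementary finite-sum and series bookkeeping
over generation 10's kernel (`T4TermwiseQuartic.interpolationError_le` / `averagingError_le`, which are ALREADY
position-dependent in the BCH remainder `ρ(y)` and the window oscillation `osc(y)`), [folklore] throughout; no sentence
of print is used as a fact; nothing printed is asserted.

THE QUESTION.  Generations 9–16 bound the action kind of the two-run ledger by ONE classical renormalisation step — the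
sandwich (U) `f₁(lift xA) − g(xA) ≤ dU_K`, (L) `g(Q yB) − f₁(yB) ≤ dL_K` — with radii UNIFORM over the torus at cutoff
`K` (size `s_K ∝ ε₁L^{−2K}`, oscillation `ω_K ∝ ε₁L^{−2K}·h_K`, BCH `ρb_K ∝ ε₁²L^{−4K}`), i.e. for level-`K` backgrounds
that are top-level-regular EVERYWHERE (the located input `hA9`/`hB9` of `TermwiseHolderNorm`, print: one run, on its
cubes □).  The remaining currency mismatch (record (20c)(ii)) is that a history of the good class may carry OLD
large-field regions, on which a run's background is regular only at the region's own level `j < K` (conditions (2) of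
[Balaban1985Variational] read per level: radii with `L^{−j}` in place of `L^{−K}`).  WHAT DOES THE SAME SANDWICH GIVE
FOR SUCH LEVEL-GRADED (heterogeneous) RADII?

WHAT IS PROVED ([folklore]).
§1 (U)/(L) with PROFILES: `interpolationError_le_of_profiles` / `averagingError_le_of_profiles` — generation 10's
   deviation bounds with the field size bounded window-wise (`‖φ x‖ ≤ sz(y)` on the window of `y`), the oscillation by
   `osc(y)`, the BCH remainder by `ρ(y)`: the error is a SUM OVER WINDOWS of `r²osc(y)²/4 + r·sz(y)·ρ(y) + q(r·sz(y) +
   ρ(y))⁴` (resp. of `r·sz(y)ρ(y) + ρ(y)²/2`, plus `q·Σ_x ‖φ x‖⁴`).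
§2 LEVEL GRADING: `sum_le_sum_levels` — a window sum of a quantity bounded by `G(lvl y)` is `≤ Σ_{j ≤ K} N_j·G_j` when at
   most `N_j` windows have level `j`.
§3 THE HETEROGENEOUS (U) BOUND AT ONE CUTOFF: `interpolationError_le_levels` — with level-`j` radii of generation 10's
   SHAPE at scale `L^{−j}` (`sz_j ≤ c₁ε₁L^{−2(j+1)}`, `ω_j ≤ c₂ε₁L^{−2(j+1)}L^{−j}`, `ρb_j ≤ c₃ε₁²L^{−4j}`) and level
   counts `N_j·L^{−4j} ≤ n₀·vol·μ_j`, the (U) error is `≤ vol·n₀·C_U(ε₁)·Σ_{j ≤ K} μ_j·(L^{−2})^j`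
   (`C_U = c₂²ε₁²/4 + c₁c₃ε₁³ + q(c₁ε₁ + c₃ε₁²)⁴`, generation 10's constant; ONE CALL of its `interpolationSize_le_scale`
   per level).  Here `μ_j` is the number of level-`j` windows in units of the level-`j` lattice count `n₀·vol·L^{4j}`:
   for windows of the cutoff-`K` lattice occupying a volume FRACTION `f_K(j)`, `μ_j = f_K(j)·L^{4(K−j)}` — the
   ROUGHNESS-WEIGHTED volume fraction (in generation 10's shape the oscillation radius of an age-`a` window,
   `a = K − j`, is `L^{3a}` times the top-level one; squared, `L^{6a} = L^{4a}·L^{2a}`, of which `L^{2a}` is what the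
   surviving rate `(L^{−2})^j = (L^{−2})^K·L^{2a}` pays and `L^{4a}` is charged to the volume fraction).
§4 SUMMABILITY CENSUS: with the age profile `φ(a) ≥ μ^{(K)}_{K−a}` (IR-anchored, `K`-uniform), the cutoff-`K` bound is the
   age convolution `ageConv φ θ K = Σ_{a+j=K} φ(a)·θ^j` (`θ = L^{−2}`), and for `0 ≤ φ`, `0 ≤ θ < 1`:
   `Summable (ageConv φ θ) ↔ Summable φ` (`summable_ageConv_iff`; Mathlib's Cauchy product one way, the `j = 0` term the
   other).  VERDICT (typed as the iff FOR THE MAJORANT — `summable_of_levels`, `summable_profile_of_summable`; the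
   instance below is PROSE, not asserted): through this majorant the term-wise action-kind sandwich extends from
   «top-level-regular everywhere» to «level-graded regular» histories exactly when the roughness-weighted age profile is
   summable, `Σ_a f(a)·L^{4a} < ∞` — about one rough window per unit COARSE volume summed over all ages, uniformly in
   `K`.  The cell's own count of Bałaban's d = 4 large-field geometry (ideation memo `IDEAS-NE7-g23.md` §0(a), a READING
   of [Balaban1989LargeFieldI] p. 175 «the bound does not give any positive power of ε … this number is a small fraction
   of the total number of steps», NOT a theorem) has `f(a)·L^{4a} ≍ L^{4a}e^{−p₀(g(a))} ≫ 1` for most ages: NOT summable.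
   So the GLOBAL one-step sandwich covers the King-type good class (no rough region at any age) and provably no
   D6-type good class with old rough regions through this majorant; matching the action kind on such histories needs a
   LOCALISED action comparison (small-field region only, with boundary terms of the kind [Balaban1988Convergent]
   (2.21)–(2.22) prints for ONE run) — NOT typed, NOT printed for two runs.  In d = 3 (`g_k² = g²L^kε`,
   [Balaban1985UV3] (5) p. 256) `e^{−p₀}` beats `L^{3a}` and the same census passes — the ideation seat's R3.
§5 toys: the uniform case `μ_j = [j = K]` recovers generation 10's `(L^{−2})^K`; a two-level instance.
v1.1 (DOCFIX, every declaration byte-identical) — AMENDMENT OF THE APPLICATION OF §4's VERDICT: §4 evaluates the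
   census with a `K`-uniform profile over ALL ages, the right question only for a class carrying rough structure of
   every age.  Under the cell's crossover interface I-3 (T4-DAG U5c: good histories carry pending structure only at
   levels `≥ jlogOf Cw K`; older structure is healed — top-level regular again — or makes the history Bad) the level
   shares vanish below the log cut and are `≤ Λ^{K−j}` PER TERM on the window, and the same majorant is summable for
   EVERY `θ < 1` by the tree's log-window device — companion module `Support/TermwiseHeterogeneousWindow`
   (`summable_of_levels_logWindow`, `summable_of_volumeFraction_logWindow`, control `not_summable_windowSum_allAges`).
   Hence the level-graded sandwich DOES reach the I-3 good class (given level-graded regularity binders on the young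
   pending windows, both runs); «King-type class only» below describes the ALL-AGES class, which the hybrid never asks
   the term-wise half to match; the residual `K`-persistent species on old HEALED islands (the coupling lag of
   [Balaban1988Convergent] (2.24)) has a `K`-uniform profile, for which §4 applies verbatim.  (Pointed out by the NE7
   ideation seat, memo g26 routes W-C/W-D.)

NOT DELIVERED / NOT CLAIMED: any lower bound (a diverging MAJORANT is not a no-go theorem about Bałaban's densities);
any statement about which histories are good (U5a/(F), carver); the localised comparison.  Value = a census entry of the
technique with its exact summability condition kernel-checked; NOT NE7, NOT summit progress.
-/

noncomputable section

open Finset _root_.Filter _root_.Topology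
open scoped BigOperators

namespace Summit.QuantumFields.BalabanUV.T4Continuum.TermwiseHeterogeneous

open Literature.MathematicalPhysics.QuantumFieldTheory.Balaban1983to89
open T4TermwiseQuartic

/-! ## §1 (U) and (L) with position-dependent radii -/

section Profiles

variable {V : Type*} [NormedAddCommGroup V] [InnerProductSpace ℝ V] {X Y : Type*}

/-- The kernel average of a transported field whose size is `≤ sz` ON THE SUPPORT of the (non-negative) weights has
norm `≤ (Σ w)·sz`. [folklore] -/
theorem norm_blockAverage_le_window (P : Finset X) {w : X → ℝ} {Φ φ : X → V} {sz : ℝ}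
    (hw : ∀ x ∈ P, 0 ≤ w x) (hΦ : ∀ x ∈ P, ‖Φ x‖ = ‖φ x‖) (hφ : ∀ x ∈ P, 0 < w x → ‖φ x‖ ≤ sz) :
    ‖∑ x ∈ P, w x • Φ x‖ ≤ (∑ x ∈ P, w x) * sz := by
  calc ‖∑ x ∈ P, w x • Φ x‖ ≤ ∑ x ∈ P, ‖w x • Φ x‖ := norm_sum_le _ _
    _ = ∑ x ∈ P, w x * ‖φ x‖ := Finset.sum_congr rfl fun x hx => by
        rw [norm_smul, Real.norm_eq_abs, abs_of_nonneg (hw x hx), hΦ x hx]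
    _ ≤ ∑ x ∈ P, w x * sz := Finset.sum_le_sum fun x hx => by
        rcases (hw x hx).eq_or_lt with h0 | hpos
        · rw [← h0]; simp
        · exact mul_le_mul_of_nonneg_left (hφ x hx hpos) (hw x hx)
    _ = (∑ x ∈ P, w x) * sz := (Finset.sum_mul _ _ _).symm

/-- **(U) WITH PROFILES.**  Generation 10's `interpolationError_le` with exact normalisation `rc ≥ 1`, the fine field of
size `≤ sz(y)` on the window of `y`, oscillation `≤ osc(y)`, BCH remainder `≤ ρ(y)` (`0 ≤ ρ(y)`):
`Σ_x e(φ x) − Σ_y e(ψ y) ≤ Σ_y (r²·osc(y)²/4 + r·sz(y)·ρ(y) + q·(r·sz(y) + ρ(y))⁴)`. [folklore] -/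
theorem interpolationError_le_of_profiles (P : Finset X) (P' : Finset Y) {w : Y → X → ℝ} {Φ : Y → X → V}
    {φ : X → V} {ψ : Y → V} {e : V → ℝ} {q r c : ℝ} {sz osc ρ : Y → ℝ}
    (he : ∀ v, ‖v‖ ^ 2 / 2 - q * ‖v‖ ^ 4 ≤ e v ∧ e v ≤ ‖v‖ ^ 2 / 2) (hq : 0 ≤ q)
    (hw : ∀ y ∈ P', ∀ x ∈ P, 0 ≤ w y x) (hrow : ∀ y ∈ P', ∑ x ∈ P, w y x = r)
    (hcol : ∀ x ∈ P, ∑ y ∈ P', w y x = c) (hrc : 1 ≤ r * c) (hΦ : ∀ y ∈ P', ∀ x ∈ P, ‖Φ y x‖ = ‖φ x‖)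
    (hsz : ∀ y ∈ P', ∀ x ∈ P, 0 < w y x → ‖φ x‖ ≤ sz y)
    (hosc : ∀ y ∈ P', ∀ x ∈ P, ∀ x' ∈ P, 0 < w y x → 0 < w y x' → ‖Φ y x - Φ y x'‖ ≤ osc y)
    (hρ0 : ∀ y ∈ P', 0 ≤ ρ y) (hρ : ∀ y ∈ P', ‖ψ y - ∑ x ∈ P, w y x • Φ y x‖ ≤ ρ y) :
    ∑ x ∈ P, e (φ x) - ∑ y ∈ P', e (ψ y)
      ≤ ∑ y ∈ P', (r ^ 2 * osc y ^ 2 / 4 + r * sz y * ρ y + q * (r * sz y + ρ y) ^ 4) := by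
  have h0 := interpolationError_le P P' he hw hrow hcol hΦ hosc hρ
  have hA : 0 ≤ ∑ x ∈ P, ‖φ x‖ ^ 2 := Finset.sum_nonneg fun x _ => by positivity
  have hW : ∀ y ∈ P', ‖∑ x ∈ P, w y x • Φ y x‖ ≤ r * sz y := fun y hy => by
    have := norm_blockAverage_le_window P (hw y hy) (hΦ y hy) (hsz y hy)
    rwa [hrow y hy] at this
  have hψ : ∀ y ∈ P', ‖ψ y‖ ≤ r * sz y + ρ y := fun y hy =>
    calc ‖ψ y‖ ≤ ‖∑ x ∈ P, w y x • Φ y x‖ + ‖ψ y - ∑ x ∈ P, w y x • Φ y x‖ := norm_le_norm_add_norm_sub' _ _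
      _ ≤ r * sz y + ρ y := add_le_add (hW y hy) (hρ y hy)
  have h1 : ∑ y ∈ P', ‖∑ x ∈ P, w y x • Φ y x‖ * ρ y ≤ ∑ y ∈ P', r * sz y * ρ y :=
    Finset.sum_le_sum fun y hy => mul_le_mul_of_nonneg_right (hW y hy) (hρ0 y hy)
  have h2 : ∑ y ∈ P', ‖ψ y‖ ^ 4 ≤ ∑ y ∈ P', (r * sz y + ρ y) ^ 4 :=
    Finset.sum_le_sum fun y hy => pow_le_pow_left₀ (norm_nonneg _) (hψ y hy) 4
  have h3 : ∑ y ∈ P', (r ^ 2 * osc y ^ 2 / 4 + r * sz y * ρ y + q * (r * sz y + ρ y) ^ 4)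
      = r ^ 2 / 4 * ∑ y ∈ P', osc y ^ 2 + ∑ y ∈ P', r * sz y * ρ y + q * ∑ y ∈ P', (r * sz y + ρ y) ^ 4 := by
    rw [Finset.sum_add_distrib, Finset.sum_add_distrib, Finset.mul_sum, Finset.mul_sum]
    refine congrArg₂ _ (congrArg₂ _ (Finset.sum_congr rfl fun y _ => by ring) rfl) rfl
  have h5 : (1 - r * c) / 2 * ∑ x ∈ P, ‖φ x‖ ^ 2 ≤ 0 := by nlinarith [hA, hrc]
  rw [h3]
  linarith [h0, h1, mul_le_mul_of_nonneg_left h2 hq, h5]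

/-- **(L) WITH PROFILES.**  Generation 10's `averagingError_le` with `rc ≤ 1`, the fine field of size `≤ sz(y)` on the
window of `y`, BCH remainder `≤ ρ(y)` (`0 ≤ ρ(y)`): `Σ_y e(ψ y) − Σ_x e(φ x) ≤ Σ_y (r·sz(y)·ρ(y) + ρ(y)²/2) +
q·Σ_x ‖φ x‖⁴`. [folklore] -/
theorem averagingError_le_of_profiles (P : Finset X) (P' : Finset Y) {w : Y → X → ℝ} {Φ : Y → X → V}
    {φ : X → V} {ψ : Y → V} {e : V → ℝ} {q r c : ℝ} {sz ρ : Y → ℝ}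
    (he : ∀ v, ‖v‖ ^ 2 / 2 - q * ‖v‖ ^ 4 ≤ e v ∧ e v ≤ ‖v‖ ^ 2 / 2)
    (hw : ∀ y ∈ P', ∀ x ∈ P, 0 ≤ w y x) (hr : 0 ≤ r) (hrow : ∀ y ∈ P', ∑ x ∈ P, w y x = r)
    (hcol : ∀ x ∈ P, ∑ y ∈ P', w y x ≤ c) (hrc : r * c ≤ 1) (hΦ : ∀ y ∈ P', ∀ x ∈ P, ‖Φ y x‖ = ‖φ x‖)
    (hsz : ∀ y ∈ P', ∀ x ∈ P, 0 < w y x → ‖φ x‖ ≤ sz y)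
    (hρ0 : ∀ y ∈ P', 0 ≤ ρ y) (hρ : ∀ y ∈ P', ‖ψ y - ∑ x ∈ P, w y x • Φ y x‖ ≤ ρ y) :
    ∑ y ∈ P', e (ψ y) - ∑ x ∈ P, e (φ x)
      ≤ ∑ y ∈ P', (r * sz y * ρ y + ρ y ^ 2 / 2) + q * ∑ x ∈ P, ‖φ x‖ ^ 4 := by
  have h0 := averagingError_le P P' he hw hr (fun y hy => (hrow y hy).le) hcol hΦ hρ
  have hA : 0 ≤ ∑ x ∈ P, ‖φ x‖ ^ 2 := Finset.sum_nonneg fun x _ => by positivity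
  have hW : ∀ y ∈ P', ‖∑ x ∈ P, w y x • Φ y x‖ ≤ r * sz y := fun y hy => by
    have := norm_blockAverage_le_window P (hw y hy) (hΦ y hy) (hsz y hy)
    rwa [hrow y hy] at this
  have h1 : ∑ y ∈ P', (‖∑ x ∈ P, w y x • Φ y x‖ * ρ y + ρ y ^ 2 / 2)
      ≤ ∑ y ∈ P', (r * sz y * ρ y + ρ y ^ 2 / 2) :=
    Finset.sum_le_sum fun y hy => add_le_add (mul_le_mul_of_nonneg_right (hW y hy) (hρ0 y hy)) le_rfl
  have h4 : (r * c - 1) / 2 * ∑ x ∈ P, ‖φ x‖ ^ 2 ≤ 0 := by nlinarith [hA, hrc]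
  linarith [h0, h1, h4]

end Profiles

/-! ## §2 Level grading of window sums -/

section Levels

variable {Y : Type*}

/-- **LEVEL-GRADED SUM.**  If every window `y ∈ P′` has a level `lvl y ≤ K`, a quantity `F y ≤ G (lvl y)` with `0 ≤ G`,
and at most `N j` windows have level `j` (`j ≤ K`), then `Σ_{y∈P′} F y ≤ Σ_{j ≤ K} N j · G j`. [folklore] -/
theorem sum_le_sum_levels (P' : Finset Y) (lvl : Y → ℕ) (K : ℕ) (hlvl : ∀ y ∈ P', lvl y ≤ K)
    {F : Y → ℝ} {G : ℕ → ℝ} (hG : ∀ j, 0 ≤ G j) (hF : ∀ y ∈ P', F y ≤ G (lvl y))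
    {N : ℕ → ℝ} (hN : ∀ j ≤ K, ((P'.filter (fun y => lvl y = j)).card : ℝ) ≤ N j) :
    ∑ y ∈ P', F y ≤ ∑ j ∈ Finset.range (K + 1), N j * G j := by
  have hmaps : ∀ y ∈ P', lvl y ∈ Finset.range (K + 1) :=
    fun y hy => Finset.mem_range.mpr (Nat.lt_succ_of_le (hlvl y hy))
  calc ∑ y ∈ P', F y ≤ ∑ y ∈ P', G (lvl y) := Finset.sum_le_sum hF
    _ = ∑ j ∈ Finset.range (K + 1), ∑ y ∈ P'.filter (fun y => lvl y = j), G (lvl y) :=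
        (Finset.sum_fiberwise_of_maps_to hmaps _).symm
    _ = ∑ j ∈ Finset.range (K + 1), ((P'.filter (fun y => lvl y = j)).card : ℝ) * G j := by
        refine Finset.sum_congr rfl fun j _ => ?_
        rw [Finset.sum_congr rfl fun y hy => by rw [(Finset.mem_filter.mp hy).2], Finset.sum_const, nsmul_eq_mul]
    _ ≤ ∑ j ∈ Finset.range (K + 1), N j * G j :=
        Finset.sum_le_sum fun j hj =>
          mul_le_mul_of_nonneg_right (hN j (Nat.le_of_lt_succ (Finset.mem_range.mp hj))) (hG j)

end Levels

/-! ## §3 The heterogeneous (U) and (L) bounds at one cutoff -/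

section Heterogeneous

variable {V : Type*} [NormedAddCommGroup V] [InnerProductSpace ℝ V] {X Y : Type*}

/-- Generation 10's (U) constant `C_U(ε₁) = c₂²ε₁²/4 + c₁c₃ε₁³ + q(c₁ε₁ + c₃ε₁²)⁴`. [folklore] -/
def cU (q c₁ c₂ c₃ ε₁ : ℝ) : ℝ := c₂ ^ 2 * ε₁ ^ 2 / 4 + c₁ * c₃ * ε₁ ^ 3 + q * (c₁ * ε₁ + c₃ * ε₁ ^ 2) ^ 4

/-- Unfolding lemma for `cU`. [folklore] -/
theorem cU_def (q c₁ c₂ c₃ ε₁ : ℝ) :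
    cU q c₁ c₂ c₃ ε₁ = c₂ ^ 2 * ε₁ ^ 2 / 4 + c₁ * c₃ * ε₁ ^ 3 + q * (c₁ * ε₁ + c₃ * ε₁ ^ 2) ^ 4 := rfl

/-- `0 ≤ cU` for non-negative `q, c₁, c₃, ε₁`. [folklore] -/
theorem cU_nonneg {q c₁ c₂ c₃ ε₁ : ℝ} (hq : 0 ≤ q) (hc₁ : 0 ≤ c₁) (hc₃ : 0 ≤ c₃) (hε₁ : 0 ≤ ε₁) :
    0 ≤ cU q c₁ c₂ c₃ ε₁ := by unfold cU; positivity

/-- **ONE LEVEL, RESCALED** — generation 10's `interpolationSize_le_scale` at scale `a = L^{−j}` for `N` windows counted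
in units of the level-`j` lattice (`N·L^{−4j} ≤ n₀·vol·μ`): the level-`j` share of the (U) error is
`≤ vol·n₀·C_U·μ·(L^{−2})^j`. [folklore] -/
theorem levelShare_le {q L n₀ vol c₁ c₂ c₃ ε₁ sz ω ρb N μ : ℝ} (hq : 0 ≤ q) (hL : 1 < L) (hn₀ : 0 ≤ n₀)
    (hvol : 0 ≤ vol) (hc₁ : 0 ≤ c₁) (hc₃ : 0 ≤ c₃) (hε₁ : 0 ≤ ε₁) (hμ : 0 ≤ μ) (j : ℕ)
    (hsz : 0 ≤ sz ∧ sz ≤ c₁ * ε₁ * ((L ^ (j + 1))⁻¹) ^ 2)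
    (hω : 0 ≤ ω ∧ ω ≤ c₂ * ε₁ * ((L ^ (j + 1))⁻¹) ^ 2 * (L ^ j)⁻¹)
    (hρb : 0 ≤ ρb ∧ ρb ≤ c₃ * ε₁ ^ 2 * ((L ^ j)⁻¹) ^ 4) (hN0 : 0 ≤ N)
    (hN : N * ((L ^ j)⁻¹) ^ 4 ≤ n₀ * (vol * μ)) :
    N * ((L ^ 2) ^ 2 * ω ^ 2 / 4 + L ^ 2 * sz * ρb + q * (L ^ 2 * sz + ρb) ^ 4)
      ≤ vol * (n₀ * cU q c₁ c₂ c₃ ε₁ * (μ * ((L ^ 2)⁻¹) ^ j)) := by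
  obtain ⟨ha0, ha1, _, _, hrb, hξ⟩ := scale_facts hL j
  have h := interpolationSize_le_scale (q := q) (r := L ^ 2) (n₀ := n₀) (vol := vol * μ) hq (by positivity) hn₀
    (mul_nonneg hvol hμ) hc₁ hc₃ hε₁ ha0 ha1 hrb hsz.1 hsz.2 hω.1 hω.2 hρb.1 hρb.2 hN0 hN
  rw [← hξ, cU_def]
  calc N * ((L ^ 2) ^ 2 * ω ^ 2 / 4 + L ^ 2 * sz * ρb + q * (L ^ 2 * sz + ρb) ^ 4)
      ≤ vol * μ * (n₀ * (c₂ ^ 2 * ε₁ ^ 2 / 4 + c₁ * c₃ * ε₁ ^ 3 + q * (c₁ * ε₁ + c₃ * ε₁ ^ 2) ^ 4)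
          * ((L ^ j)⁻¹) ^ 2) := h
    _ = vol * (n₀ * (c₂ ^ 2 * ε₁ ^ 2 / 4 + c₁ * c₃ * ε₁ ^ 3 + q * (c₁ * ε₁ + c₃ * ε₁ ^ 2) ^ 4)
          * (μ * ((L ^ j)⁻¹) ^ 2)) := by ring

/-- **THE HETEROGENEOUS (U) BOUND AT ONE CUTOFF.**  One classical step (row sums `L²`, column sums `L⁻²`, `1 < L`) on a
window set `P′` graded by levels `lvl y ≤ K`; on the windows of level `j` the fine field has size `≤ sz_j`, the
transported field oscillates by `≤ ω_j`, the BCH remainder is `≤ ρb_j`, with generation 10's size laws AT SCALE `L^{−j}`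
(`sz_j ≤ c₁ε₁L^{−2(j+1)}`, `ω_j ≤ c₂ε₁L^{−2(j+1)}L^{−j}`, `ρb_j ≤ c₃ε₁²L^{−4j}`); at most `N_j` windows have level `j`,
with `N_j·L^{−4j} ≤ n₀·vol·μ_j` (`μ_j` = the roughness-weighted volume fraction).  Then
`Σ_x e(φ x) − Σ_y e(ψ y) ≤ vol·n₀·C_U(ε₁)·Σ_{j ≤ K} μ_j·(L^{−2})^j`.  The uniform case (`μ_j = [j = K]`) is generation 10's
`(L^{−2})^K`. [folklore] -/
theorem interpolationError_le_levels (P : Finset X) (P' : Finset Y) {w : Y → X → ℝ} {Φ : Y → X → V}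
    {φ : X → V} {ψ : Y → V} {e : V → ℝ} {q L n₀ vol c₁ c₂ c₃ ε₁ : ℝ} (lvl : Y → ℕ) (K : ℕ)
    {sz ω ρb N μ : ℕ → ℝ}
    (he : ∀ v, ‖v‖ ^ 2 / 2 - q * ‖v‖ ^ 4 ≤ e v ∧ e v ≤ ‖v‖ ^ 2 / 2) (hq : 0 ≤ q) (hL : 1 < L)
    (hw : ∀ y ∈ P', ∀ x ∈ P, 0 ≤ w y x) (hrow : ∀ y ∈ P', ∑ x ∈ P, w y x = L ^ 2)
    (hcol : ∀ x ∈ P, ∑ y ∈ P', w y x = (L ^ 2)⁻¹) (hΦ : ∀ y ∈ P', ∀ x ∈ P, ‖Φ y x‖ = ‖φ x‖)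
    (hlvl : ∀ y ∈ P', lvl y ≤ K)
    (hszw : ∀ y ∈ P', ∀ x ∈ P, 0 < w y x → ‖φ x‖ ≤ sz (lvl y))
    (hoscw : ∀ y ∈ P', ∀ x ∈ P, ∀ x' ∈ P, 0 < w y x → 0 < w y x' → ‖Φ y x - Φ y x'‖ ≤ ω (lvl y))
    (hρw : ∀ y ∈ P', ‖ψ y - ∑ x ∈ P, w y x • Φ y x‖ ≤ ρb (lvl y))
    (hn₀ : 0 ≤ n₀) (hvol : 0 ≤ vol) (hc₁ : 0 ≤ c₁) (hc₃ : 0 ≤ c₃) (hε₁ : 0 ≤ ε₁)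
    (hsz : ∀ j, 0 ≤ sz j ∧ sz j ≤ c₁ * ε₁ * ((L ^ (j + 1))⁻¹) ^ 2)
    (hω : ∀ j, 0 ≤ ω j ∧ ω j ≤ c₂ * ε₁ * ((L ^ (j + 1))⁻¹) ^ 2 * (L ^ j)⁻¹)
    (hρb : ∀ j, 0 ≤ ρb j ∧ ρb j ≤ c₃ * ε₁ ^ 2 * ((L ^ j)⁻¹) ^ 4)
    (hμ : ∀ j, 0 ≤ μ j) (hN0 : ∀ j, 0 ≤ N j)
    (hNc : ∀ j ≤ K, ((P'.filter (fun y => lvl y = j)).card : ℝ) ≤ N j)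
    (hN : ∀ j ≤ K, N j * ((L ^ j)⁻¹) ^ 4 ≤ n₀ * (vol * μ j)) :
    ∑ x ∈ P, e (φ x) - ∑ y ∈ P', e (ψ y)
      ≤ vol * (n₀ * cU q c₁ c₂ c₃ ε₁ * ∑ j ∈ Finset.range (K + 1), μ j * ((L ^ 2)⁻¹) ^ j) := by
  have hL0 : 0 < L := by linarith
  have hrc : (1 : ℝ) ≤ L ^ 2 * (L ^ 2)⁻¹ := by rw [mul_inv_cancel₀ (pow_ne_zero 2 hL0.ne')]
  -- §1 with the level profiles
  have h1 := interpolationError_le_of_profiles P P' (sz := fun y => sz (lvl y)) (osc := fun y => ω (lvl y))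
    (ρ := fun y => ρb (lvl y)) he hq hw hrow hcol hrc hΦ hszw hoscw (fun y _ => (hρb _).1) hρw
  -- §2 grading with G j = the level-j window share
  have hG : ∀ j, 0 ≤ (L ^ 2) ^ 2 * ω j ^ 2 / 4 + L ^ 2 * sz j * ρb j + q * (L ^ 2 * sz j + ρb j) ^ 4 := fun j => by
    have := (hsz j).1; have := (hω j).1; have := (hρb j).1; positivity
  have h2 := sum_le_sum_levels P' lvl K hlvl hG (F := fun y =>
      (L ^ 2) ^ 2 * ω (lvl y) ^ 2 / 4 + L ^ 2 * sz (lvl y) * ρb (lvl y) + q * (L ^ 2 * sz (lvl y) + ρb (lvl y)) ^ 4)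
    (fun y _ => le_rfl) hNc
  -- per level, generation 10's scaling at scale L^{-j}
  have h3 : ∑ j ∈ Finset.range (K + 1),
        N j * ((L ^ 2) ^ 2 * ω j ^ 2 / 4 + L ^ 2 * sz j * ρb j + q * (L ^ 2 * sz j + ρb j) ^ 4)
      ≤ ∑ j ∈ Finset.range (K + 1), vol * (n₀ * cU q c₁ c₂ c₃ ε₁ * (μ j * ((L ^ 2)⁻¹) ^ j)) :=
    Finset.sum_le_sum fun j hj => levelShare_le hq hL hn₀ hvol hc₁ hc₃ hε₁ (hμ j) j (hsz j) (hω j) (hρb j) (hN0 j)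
      (hN j (Nat.le_of_lt_succ (Finset.mem_range.mp hj)))
  rw [Finset.mul_sum, Finset.mul_sum]
  exact h1.trans (h2.trans h3)

end Heterogeneous

/-! ## §4 Summability census: age convolutions -/

section AgeConv

/-- The AGE CONVOLUTION `ageConv φ θ K = Σ_{(a,j): a+j=K} φ(a)·θ^j` — the cutoff-`K` majorant when the level-`j` share is
`φ(K − j)·θ^j` (age `a = K − j`, rate `θ = L^{−2}`). [folklore] -/
def ageConv (φ : ℕ → ℝ) (θ : ℝ) (K : ℕ) : ℝ := ∑ p ∈ antidiagonal K, φ p.1 * θ ^ p.2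

/-- Unfolding lemma. [folklore] -/
theorem ageConv_def (φ : ℕ → ℝ) (θ : ℝ) (K : ℕ) :
    ageConv φ θ K = ∑ p ∈ antidiagonal K, φ p.1 * θ ^ p.2 := rfl

/-- `0 ≤ ageConv φ θ K` for `0 ≤ φ`, `0 ≤ θ`. [folklore] -/
theorem ageConv_nonneg {φ : ℕ → ℝ} {θ : ℝ} (hφ : ∀ a, 0 ≤ φ a) (hθ : 0 ≤ θ) (K : ℕ) : 0 ≤ ageConv φ θ K :=
  Finset.sum_nonneg fun p _ => mul_nonneg (hφ p.1) (pow_nonneg hθ p.2)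

/-- The oldest age alone: `φ K ≤ ageConv φ θ K` (the term `(K, 0)`), for `0 ≤ φ`, `0 ≤ θ`. [folklore] -/
theorem le_ageConv {φ : ℕ → ℝ} {θ : ℝ} (hφ : ∀ a, 0 ≤ φ a) (hθ : 0 ≤ θ) (K : ℕ) : φ K ≤ ageConv φ θ K := by
  have hmem : (K, 0) ∈ antidiagonal K := by simp
  have := Finset.single_le_sum (f := fun p : ℕ × ℕ => φ p.1 * θ ^ p.2)
    (fun p _ => mul_nonneg (hφ _) (pow_nonneg hθ _)) hmem
  simpa [ageConv] using this

/-- The level-indexed sum with an IR-anchored age profile is dominated by the age convolution: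
`μ_j ≤ φ(K − j)` for `j ≤ K` gives `Σ_{j ≤ K} μ_j θ^j ≤ ageConv φ θ K` (`0 ≤ θ`). [folklore] -/
theorem sum_range_le_ageConv {μ φ : ℕ → ℝ} {θ : ℝ} (hθ : 0 ≤ θ) (K : ℕ) (hμ : ∀ j ≤ K, μ j ≤ φ (K - j)) :
    ∑ j ∈ Finset.range (K + 1), μ j * θ ^ j ≤ ageConv φ θ K := by
  rw [ageConv, Finset.Nat.sum_antidiagonal_eq_sum_range_succ (fun a j => φ a * θ ^ j) K,
    ← Finset.sum_range_reflect (fun j => φ j * θ ^ (K - j)) (K + 1)]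
  refine Finset.sum_le_sum fun j hj => ?_
  have hjK : j ≤ K := Nat.le_of_lt_succ (Finset.mem_range.mp hj)
  simp only [Nat.add_sub_cancel, Nat.sub_sub_self hjK]
  exact mul_le_mul_of_nonneg_right (hμ j hjK) (pow_nonneg hθ _)

/-- **SUMMABILITY OF AGE CONVOLUTIONS (⇐).**  `Σ φ < ∞`, `0 ≤ φ`, `0 ≤ θ < 1` ⇒ `Σ_K ageConv φ θ K < ∞` (Cauchy product
of two absolutely summable real series). [folklore] -/
theorem summable_ageConv {φ : ℕ → ℝ} {θ : ℝ} (hφ0 : ∀ a, 0 ≤ φ a) (hφ : Summable φ) (hθ0 : 0 ≤ θ) (hθ1 : θ < 1) :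
    Summable (ageConv φ θ) := by
  have hφn : Summable (fun a => ‖φ a‖) := hφ.congr fun a => by rw [Real.norm_eq_abs, abs_of_nonneg (hφ0 a)]
  have hg : Summable (fun j : ℕ => θ ^ j) := summable_geometric_of_lt_one hθ0 hθ1
  have hgn : Summable (fun j : ℕ => ‖θ ^ j‖) :=
    hg.congr fun j => by rw [Real.norm_eq_abs, abs_of_nonneg (pow_nonneg hθ0 j)]
  have h : Summable (fun K : ℕ => ∑ p ∈ antidiagonal K, φ p.1 * θ ^ p.2) :=
    summable_sum_mul_antidiagonal_of_summable_norm' hφn hφ hgn hg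
  exact h

/-- **SUMMABILITY OF AGE CONVOLUTIONS (⇔).**  For `0 ≤ φ`, `0 ≤ θ < 1`: `Summable (ageConv φ θ) ↔ Summable φ` — the
roughness-weighted age profile must itself be summable; no rate in `j` can compensate a non-summable profile, because
the oldest age enters every cutoff with `θ⁰ = 1`. [folklore] -/
theorem summable_ageConv_iff {φ : ℕ → ℝ} {θ : ℝ} (hφ0 : ∀ a, 0 ≤ φ a) (hθ0 : 0 ≤ θ) (hθ1 : θ < 1) :
    Summable (ageConv φ θ) ↔ Summable φ :=
  ⟨fun h => Summable.of_nonneg_of_le hφ0 (le_ageConv hφ0 hθ0) h, fun h => summable_ageConv hφ0 h hθ0 hθ1⟩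

/-- **THE CENSUS, COMBINED.**  If at every cutoff `K` the (per-volume) action-kind error is bounded by the heterogeneous
majorant with an IR-anchored, `K`-uniform age profile — `δ K ≤ C·Σ_{j ≤ K} μ_K(j)·θ^j` with `μ_K(j) ≤ φ(K − j)`, `0 ≤ δ`,
`0 ≤ C`, `0 ≤ θ < 1` — and `Σ_a φ(a) < ∞`, then `Σ_K δ K < ∞`. [folklore] -/
theorem summable_of_levels {δ : ℕ → ℝ} {μ : ℕ → ℕ → ℝ} {φ : ℕ → ℝ} {C θ : ℝ} (hC : 0 ≤ C) (hθ0 : 0 ≤ θ)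
    (hθ1 : θ < 1) (hφ0 : ∀ a, 0 ≤ φ a) (hφ : Summable φ) (hδ0 : ∀ K, 0 ≤ δ K)
    (hδ : ∀ K, δ K ≤ C * ∑ j ∈ Finset.range (K + 1), μ K j * θ ^ j) (hμ : ∀ K, ∀ j ≤ K, μ K j ≤ φ (K - j)) :
    Summable δ := by
  refine Summable.of_nonneg_of_le hδ0 (fun K => (hδ K).trans ?_) ((summable_ageConv hφ0 hφ hθ0 hθ1).mul_left C)
  exact mul_le_mul_of_nonneg_left (sum_range_le_ageConv hθ0 K (hμ K)) hC

/-- **THE CENSUS, CONVERSE SIDE (for the majorant).**  If the majorant is ATTAINED at the oldest age —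
`C·φ(K) ≤ δ K` for every `K` with `0 < C`, `0 ≤ φ` — then `Σ_K δ K < ∞` forces `Σ_a φ(a) < ∞`: a non-summable
roughness-weighted age profile leaves the term-wise action-kind majorant non-summable (a statement about the MAJORANT,
not a lower bound on Bałaban's densities). [folklore] -/
theorem summable_profile_of_summable {δ φ : ℕ → ℝ} {C : ℝ} (hC : 0 < C) (hφ0 : ∀ a, 0 ≤ φ a)
    (hδ : ∀ K, C * φ K ≤ δ K) (hs : Summable δ) : Summable φ := by
  have h : Summable (fun K => C * φ K) :=
    Summable.of_nonneg_of_le (fun K => mul_nonneg hC.le (hφ0 K)) hδ hs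
  have h' := h.mul_left C⁻¹
  simp_rw [← mul_assoc, inv_mul_cancel₀ hC.ne', one_mul] at h'
  exact h'

end AgeConv

/-! ## §5 Toys: the uniform case is generation 10's rate; a two-level instance; a non-summable profile -/

section Toy

/-- The uniform case: with `μ_j = [j = K]` the level sum is generation 10's geometric factor `(L^{−2})^K`. [folklore] -/
theorem levels_uniform (L : ℝ) (K : ℕ) :
    ∑ j ∈ Finset.range (K + 1), (if j = K then (1 : ℝ) else 0) * ((L ^ 2)⁻¹) ^ j = ((L ^ 2)⁻¹) ^ K := by
  rw [Finset.sum_eq_single K (fun j _ hj => by simp [hj]) (fun h => absurd (Finset.self_mem_range_succ K) h)]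
  simp

/-- Two levels (`K = 1`, `θ = 1/4`): a top-level fraction `μ₁ = 1` and an age-1 roughness-weighted fraction `μ₀ = 16·f`
give the majorant `16 f + 1/4` — the rough share is NOT discounted by the rate. [folklore] -/
example (f : ℝ) :
    ∑ j ∈ Finset.range 2, (if j = 1 then (1 : ℝ) else 16 * f) * ((1 : ℝ) / 4) ^ j = 16 * f + 1 / 4 := by
  simp [Finset.sum_range_succ]

/-- A constant age profile `φ ≡ 1` (one rough window's worth per unit volume at EVERY age) is not summable, hence
neither is its age convolution, whatever the rate `θ ∈ [0,1)`. [folklore] -/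
example {θ : ℝ} (hθ0 : 0 ≤ θ) (hθ1 : θ < 1) : ¬ Summable (ageConv (fun _ => (1 : ℝ)) θ) := by
  rw [summable_ageConv_iff (fun _ => zero_le_one) hθ0 hθ1]
  intro h
  have := h.tendsto_atTop_zero
  have h1 : Filter.Tendsto (fun _ : ℕ => (1 : ℝ)) Filter.atTop (nhds 1) := tendsto_const_nhds
  exact one_ne_zero (tendsto_nhds_unique h1 this)

end Toy

end Summit.QuantumFields.BalabanUV.T4Continuum.TermwiseHeterogeneous
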